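import Literature.NumberTheory.LFunctions.RiemannSiegelStirling
import Literature.NumberTheory.LFunctions.KeiperLiTrend
import Literature.NumberTheory.LFunctions.ZetaZeroSumsLehmanExplicit
import HarnessLib

/-!
# RH-FREE — Second-order Stirling for the Riemann–Siegel theta function: `|θ(t) − ((t/2) log(t/2π) − t/2 − π/8 + 1/(48t))| ≤ 0.53/t³` (`t ≥ 2`), hence `|Q(t) − S(t) − 1/(48πt)| ≤ 0.53/(πt³)` and Brent–Platt–Trudgian's Lemma 2 `|Q − S| ≤ 1/(150t)` for `t ≥ 70` («nothing here bears on the truth of RH»)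

Topic `Literature/NumberTheory/LFunctions` (RH literature-typing tranche 1, L4 "explicit zero
statistics", gen 7). Label: **RH-FREE**. THEOREMS only — NO definition, NO new named fact (D-0026).
Nothing here bears on the truth of RH.

The tree's `RiemannSiegelStirling.lean` proves the FIRST-order Stirling bound
`|θ(t) − ((t/2) log(t/2π) − t/2 − π/8)| ≤ 2K(¼)/t` (`abs_riemannSiegelTheta_sub_stirling_le`, `K(¼) < 0.6`)
by integrating `|Re ψ(σ+iu) − log u| ≤ K(σ)/u²` from `τ = t/2` to `∞`
(`θ(t) = argGammaVert ¼ (t/2) − (t/2) log π`). This file does the same one order further, with the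
tree's explicit Stirling series for `ψ` of order `ν = 2`
(`norm_digamma_sub_stirling_four_le`: `‖ψ(w) − Log w + 1/(2w) + 1/(12w²) − 1/(120w⁴)‖ ≤ 5/(4π³‖w‖⁴ Re w)`,
`KeiperLiTrend.lean`, from `Literature/Analysis/SpecialFunctions/DigammaStirlingSeries.lean`):

* `abs_re_digamma_vertical_sub_log_sub_le` — **`|Re ψ(σ+iu) − log u − a(σ)/u²| ≤ K₂(σ)/u⁴`** for
  `σ > 0`, `u ≥ 1`, with `a(σ) = σ²/2 − σ/2 + 1/12` (the `u⁻²` coefficient of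
  `Re[Log w − 1/(2w) − 1/(12w²)]`, `w = σ + iu`) and
  `K₂(σ) = σ⁴/2 + σ³/2 + (3σ² + σ⁴)/12 + 1/120 + 5/(4π³σ)` (two-sided elementary expansions of
  `½ log(1 + σ²/u²)`, `σ/(2(σ²+u²))`, `Re 1/(12w²) = (σ²−u²)/(12(σ²+u²)²)`, `|Re 1/(120w⁴)| ≤ 1/(120u⁴)`).
* `abs_argGammaVert_sub_stirling_two_le` — **`|arg Γ(σ+iτ) − (τ log τ − τ) − c(σ) + a(σ)/τ| ≤ K₂(σ)/(3τ³)`**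
  (`τ ≥ 1`): `E(τ) − c(σ) = −∫_τ^∞ (Re ψ(σ+iu) − log u) du = −a(σ)/τ − ∫_τ^∞ r₂`.
* `abs_riemannSiegelTheta_sub_stirling_two_le` — at `σ = ¼` (`a(¼) = −1/96`, `c(¼) = −π/8`,
  `8K₂(¼)/3 < 0.53`): **`|θ(t) − ((t/2) log(t/2π) − t/2 − π/8 + 1/(48t))| ≤ 0.53/t³`** for `t ≥ 2`
  (the next term of the true expansion is `7/(5760t³)`; Brent–Platt–Trudgian 2021, proof of Lemma 2,
  use Brent's sharp remainder for three terms).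
* `count_sub_countMain_sub_zetaArgS_eq` — `Q(t) − S(t) = (θ(t) − ((t/2) log(t/2π) − t/2 − π/8))/π`
  (`N = θ/π + 1 + S`, `L(t) = countMain t`); `abs_count_sub_countMain_sub_zetaArgS_sub_le` —
  **`|Q(t) − S(t) − 1/(48πt)| ≤ 0.53/(πt³)`** (`t ≥ 2`; the tree had `|Q − S| ≤ 1.2/(πt)`,
  `abs_zetaZeroCount_sub_main_sub_zetaArgS_le`); and `BrentPlattTrudgian2021_lemma2.of_seventy_le` —
  the inequality `|Q(t) − S(t)| ≤ 1/(150t)` of the named fact `BrentPlattTrudgian2021_lemma2` PROVED for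
  `t ≥ 70` (the printed range is `t ≥ 2π`; on `[2π, 70]` the constant `0.53` would have to come down
  to `0.0043`, i.e. Brent's three-term remainder — not done here).

## References

* R. P. Brent, D. J. Platt, T. S. Trudgian, Math. Comp. 90 (2021) 2923–2935, Lemma 2 and its proof.
  [BrentPlattTrudgian2021]
* G. E. Andrews, R. Askey, R. Roy, *Special Functions* (1999), Cor. 1.4.5 (Stirling's series for `ψ`).
  [AndrewsAskeyRoy1999]
* E. C. Titchmarsh, *The Theory of the Riemann Zeta-Function*, 2nd ed. (1986), §4.17, Thm. 9.3.
  [Titchmarsh1986]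
-/

noncomputable section

open Complex Real Set Filter Topology MeasureTheory intervalIntegral

namespace Literature.NumberTheory.LFunctions

open SchoenfeldBound

/-! ### The pointwise second-order Stirling bound for `Re ψ` on a vertical line -/

/-- **`|Re ψ(σ+iu) − log u − (σ²/2 − σ/2 + 1/12)/u²| ≤ K₂(σ)/u⁴`** for `σ > 0`, `u ≥ 1`, with
`K₂(σ) = σ⁴/2 + σ³/2 + (3σ²+σ⁴)/12 + 1/120 + 5/(4π³σ)`, from the order-`2` Stirling series for `ψ`
with explicit remainder and elementary two-sided expansions of the real parts of its terms.
[cite: AndrewsAskeyRoy1999, Cor 1.4.5] -/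
theorem abs_re_digamma_vertical_sub_log_sub_le {σ u : ℝ} (hσ : 0 < σ) (hu : 1 ≤ u) :
    |(digamma (σ + u * I)).re - Real.log u - (σ ^ 2 / 2 - σ / 2 + 1 / 12) / u ^ 2| ≤
      (σ ^ 4 / 2 + σ ^ 3 / 2 + (3 * σ ^ 2 + σ ^ 4) / 12 + 1 / 120 + 5 / (4 * π ^ 3 * σ)) / u ^ 4 := by
  set w : ℂ := σ + u * I with hw
  have hwre : w.re = σ := by simp [hw]
  have hwim : w.im = u := by simp [hw]
  have hu0 : 0 < u := by linarith
  have hsu : 0 < σ ^ 2 + u ^ 2 := by positivity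
  -- norms
  have hnorm2 : ‖w‖ ^ 2 = σ ^ 2 + u ^ 2 := by
    rw [Complex.sq_norm, Complex.normSq_apply, hwre, hwim]; ring
  have hnorm_ge : u ≤ ‖w‖ := by
    have := Complex.abs_im_le_norm w
    rwa [hwim, abs_of_pos hu0] at this
  have hnorm0 : 0 < ‖w‖ := hu0.trans_le hnorm_ge
  have hnorm4 : u ^ 4 ≤ ‖w‖ ^ 4 := pow_le_pow_left₀ hu0.le hnorm_ge 4
  -- the Stirling remainder and its real part
  set R : ℂ := digamma w - Complex.log w + 1 / (2 * w) + 1 / (12 * w ^ 2) - 1 / (120 * w ^ 4)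
    with hRdef
  have hR : ‖R‖ ≤ 5 / (4 * π ^ 3) / (‖w‖ ^ 4 * σ) := by
    have := norm_digamma_sub_stirling_four_le (w := w) (by rw [hwre]; exact hσ)
    rwa [hwre] at this
  have hRre : |R.re| ≤ (5 / (4 * π ^ 3 * σ)) / u ^ 4 := by
    calc |R.re| ≤ ‖R‖ := Complex.abs_re_le_norm R
      _ ≤ 5 / (4 * π ^ 3) / (‖w‖ ^ 4 * σ) := hR
      _ ≤ 5 / (4 * π ^ 3) / (u ^ 4 * σ) := by
          apply div_le_div_of_nonneg_left (by positivity) (by positivity)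
          exact mul_le_mul_of_nonneg_right hnorm4 hσ.le
      _ = (5 / (4 * π ^ 3 * σ)) / u ^ 4 := by
          field_simp
  -- A : `log ‖w‖ − log u = ½ log(1 + σ²/u²) ∈ [σ²/(2u²) − σ⁴/(2u⁴), σ²/(2u²)]`
  have hlogre : (Complex.log w).re = Real.log ‖w‖ := Complex.log_re w
  have hL : Real.log ‖w‖ - Real.log u = Real.log ((σ ^ 2 + u ^ 2) / u ^ 2) / 2 := by
    have h1 : Real.log (‖w‖ ^ 2) = 2 * Real.log ‖w‖ := by rw [Real.log_pow]; norm_num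
    have h2 : Real.log (u ^ 2) = 2 * Real.log u := by rw [Real.log_pow]; norm_num
    rw [Real.log_div hsu.ne' (by positivity), ← hnorm2, h1, h2]
    ring
  have hA1 : Real.log ‖w‖ - Real.log u - σ ^ 2 / (2 * u ^ 2) ≤ 0 := by
    rw [hL]
    have := Real.log_le_sub_one_of_pos (x := (σ ^ 2 + u ^ 2) / u ^ 2) (by positivity)
    have e : (σ ^ 2 + u ^ 2) / u ^ 2 - 1 = σ ^ 2 / u ^ 2 := by field_simp; ring
    have e2 : σ ^ 2 / (2 * u ^ 2) = σ ^ 2 / u ^ 2 / 2 := by ring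
    rw [e] at this
    rw [e2]
    linarith
  have hA0 : -(σ ^ 4 / (2 * u ^ 4)) ≤ Real.log ‖w‖ - Real.log u - σ ^ 2 / (2 * u ^ 2) := by
    rw [hL]
    have h1 := Real.one_sub_inv_le_log_of_pos (show 0 < (σ ^ 2 + u ^ 2) / u ^ 2 by positivity)
    have e1 : 1 - ((σ ^ 2 + u ^ 2) / u ^ 2)⁻¹ = σ ^ 2 / (σ ^ 2 + u ^ 2) := by
      field_simp
      ring
    rw [e1] at h1
    have h2 : σ ^ 2 / u ^ 2 - σ ^ 4 / u ^ 4 ≤ σ ^ 2 / (σ ^ 2 + u ^ 2) := by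
      rw [div_sub_div _ _ (by positivity) (by positivity), div_le_div_iff₀ (by positivity) hsu]
      have : 0 ≤ σ ^ 6 * u ^ 2 := by positivity
      nlinarith
    have e3 : σ ^ 2 / (2 * u ^ 2) = σ ^ 2 / u ^ 2 / 2 := by ring
    have e4 : σ ^ 4 / (2 * u ^ 4) = σ ^ 4 / u ^ 4 / 2 := by ring
    rw [e3, e4]
    linarith
  -- B : `Re 1/(2w) = σ/(2(σ²+u²)) ∈ [σ/(2u²) − σ³/(2u⁴), σ/(2u²)]`
  have hB : (1 / (2 * w)).re = σ / (2 * (σ ^ 2 + u ^ 2)) := by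
    rw [one_div, Complex.inv_re, Complex.normSq_apply]
    simp [hw]
    field_simp
  have hBdiff : σ / (2 * u ^ 2) - (1 / (2 * w)).re = σ ^ 3 / (2 * u ^ 2 * (σ ^ 2 + u ^ 2)) := by
    rw [hB]
    field_simp
    ring
  have hB0 : 0 ≤ σ / (2 * u ^ 2) - (1 / (2 * w)).re := by rw [hBdiff]; positivity
  have hB1 : σ / (2 * u ^ 2) - (1 / (2 * w)).re ≤ σ ^ 3 / (2 * u ^ 4) := by
    rw [hBdiff]
    apply div_le_div_of_nonneg_left (by positivity) (by positivity)
    nlinarith [sq_nonneg σ, pow_pos hu0 2]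
  -- C : `Re 1/(12w²) = (σ² − u²)/(12(σ²+u²)²)`, so `C + 1/(12u²) = (3σ²u² + σ⁴)/(12u²(σ²+u²)²)`
  set A : ℝ := σ ^ 2 - u ^ 2 with hA_def
  set B : ℝ := 2 * σ * u with hB_def
  have hw2 : w ^ 2 = (A : ℂ) + (B : ℂ) * I := by
    rw [hw, hA_def, hB_def]
    apply Complex.ext
    · simp [sq]
    · simp [sq]; ring
  have hAB : A ^ 2 + B ^ 2 = (σ ^ 2 + u ^ 2) ^ 2 := by rw [hA_def, hB_def]; ring
  have hABne : A ^ 2 + B ^ 2 ≠ 0 := by rw [hAB]; positivity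
  have hC0' : (1 / (12 * w ^ 2)).re = A / (12 * (A ^ 2 + B ^ 2)) := by
    rw [hw2, one_div, Complex.inv_re, Complex.normSq_apply]
    have hre : ((12 : ℂ) * ((A : ℂ) + (B : ℂ) * I)).re = 12 * A := by simp
    have him : ((12 : ℂ) * ((A : ℂ) + (B : ℂ) * I)).im = 12 * B := by simp
    rw [hre, him]
    have hden : 12 * A * (12 * A) + 12 * B * (12 * B) = 144 * (A ^ 2 + B ^ 2) := by ring
    rw [hden]
    field_simp
    ring
  have hC : (1 / (12 * w ^ 2)).re = (σ ^ 2 - u ^ 2) / (12 * (σ ^ 2 + u ^ 2) ^ 2) := by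
    rw [hC0', hAB]
  have hCsum : (1 / (12 * w ^ 2)).re + 1 / (12 * u ^ 2) =
      (3 * σ ^ 2 * u ^ 2 + σ ^ 4) / (12 * u ^ 2 * (σ ^ 2 + u ^ 2) ^ 2) := by
    rw [hC]
    field_simp
    ring
  have hC0 : 0 ≤ (1 / (12 * w ^ 2)).re + 1 / (12 * u ^ 2) := by rw [hCsum]; positivity
  have hC1 : (1 / (12 * w ^ 2)).re + 1 / (12 * u ^ 2) ≤ (3 * σ ^ 2 + σ ^ 4) / (12 * u ^ 4) := by
    rw [hCsum, div_le_div_iff₀ (by positivity) (by positivity)]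
    have hu2 : 1 ≤ u ^ 2 := by nlinarith
    have h4 : u ^ 4 ≤ (σ ^ 2 + u ^ 2) ^ 2 := by nlinarith [sq_nonneg σ]
    have e1 : (3 * σ ^ 2 * u ^ 2 + σ ^ 4) * (12 * u ^ 4) = 12 * (3 * σ ^ 2 * u ^ 6 + σ ^ 4 * u ^ 4) := by
      ring
    have e2 : (3 * σ ^ 2 + σ ^ 4) * (12 * u ^ 2 * (σ ^ 2 + u ^ 2) ^ 2) =
        12 * (3 * σ ^ 2 + σ ^ 4) * u ^ 2 * (σ ^ 2 + u ^ 2) ^ 2 := by ring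
    rw [e1, e2]
    have h5 : 12 * (3 * σ ^ 2 * u ^ 6 + σ ^ 4 * u ^ 4) ≤ 12 * (3 * σ ^ 2 + σ ^ 4) * u ^ 2 * u ^ 4 := by
      have h46 : σ ^ 4 * u ^ 4 ≤ σ ^ 4 * u ^ 6 := by
        apply mul_le_mul_of_nonneg_left _ (by positivity)
        calc u ^ 4 = u ^ 4 * 1 := by ring
          _ ≤ u ^ 4 * u ^ 2 := by gcongr
          _ = u ^ 6 := by ring
      have e : 12 * (3 * σ ^ 2 + σ ^ 4) * u ^ 2 * u ^ 4 - 12 * (3 * σ ^ 2 * u ^ 6 + σ ^ 4 * u ^ 4)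
          = 12 * (σ ^ 4 * u ^ 6 - σ ^ 4 * u ^ 4) := by ring
      linarith [e, h46]
    have h6 : 12 * (3 * σ ^ 2 + σ ^ 4) * u ^ 2 * u ^ 4 ≤
        12 * (3 * σ ^ 2 + σ ^ 4) * u ^ 2 * (σ ^ 2 + u ^ 2) ^ 2 :=
      mul_le_mul_of_nonneg_left h4 (by positivity)
    linarith
  -- D : `|Re 1/(120w⁴)| ≤ 1/(120u⁴)`
  have hD : |(1 / (120 * w ^ 4)).re| ≤ 1 / (120 * u ^ 4) := by
    calc |(1 / (120 * w ^ 4)).re| ≤ ‖1 / (120 * w ^ 4)‖ := Complex.abs_re_le_norm _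
      _ = 1 / (120 * ‖w‖ ^ 4) := by simp [norm_pow]
      _ ≤ 1 / (120 * u ^ 4) := by
          apply div_le_div_of_nonneg_left (by norm_num) (by positivity)
          exact mul_le_mul_of_nonneg_left hnorm4 (by norm_num)
  -- assemble
  have hRre_eq : R.re = (digamma w).re - Real.log ‖w‖ + (1 / (2 * w)).re + (1 / (12 * w ^ 2)).re
      - (1 / (120 * w ^ 4)).re := by
    simp only [hRdef, Complex.sub_re, Complex.add_re, hlogre]
  have key : (digamma w).re - Real.log u - (σ ^ 2 / 2 - σ / 2 + 1 / 12) / u ^ 2 =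
      R.re + (Real.log ‖w‖ - Real.log u - σ ^ 2 / (2 * u ^ 2))
        + (σ / (2 * u ^ 2) - (1 / (2 * w)).re)
        - ((1 / (12 * w ^ 2)).re + 1 / (12 * u ^ 2)) + (1 / (120 * w ^ 4)).re := by
    rw [hRre_eq]
    field_simp
    ring
  rw [key]
  have hDle := (abs_le.1 hD)
  have hRle := (abs_le.1 hRre)
  have esum : (σ ^ 4 / 2 + σ ^ 3 / 2 + (3 * σ ^ 2 + σ ^ 4) / 12 + 1 / 120 + 5 / (4 * π ^ 3 * σ)) / u ^ 4
      = σ ^ 4 / (2 * u ^ 4) + σ ^ 3 / (2 * u ^ 4) + (3 * σ ^ 2 + σ ^ 4) / (12 * u ^ 4)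
        + 1 / (120 * u ^ 4) + (5 / (4 * π ^ 3 * σ)) / u ^ 4 := by
    ring
  rw [esum, abs_le]
  constructor <;> linarith

/-! ### Integrated: `arg Γ(σ+iτ)` to second order -/

/-- **`|arg Γ(σ+iτ) − (τ log τ − τ) − c(σ) + a(σ)/τ| ≤ K₂(σ)/(3τ³)`** for `σ > 0`, `τ ≥ 1`
(`a(σ) = σ²/2 − σ/2 + 1/12`; `c(σ) = stirlingArgConst σ`): the tree's identity
`argGammaVert σ τ − (τ log τ − τ) − c(σ) = −∫_τ^∞ (Re ψ(σ+iu) − log u) du` with the integrand split as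
`a(σ)/u² + r₂(u)`, `|r₂(u)| ≤ K₂(σ)/u⁴`. [cite: AndrewsAskeyRoy1999, Cor 1.4.5] -/
theorem abs_argGammaVert_sub_stirling_two_le {σ : ℝ} (hσ : 0 < σ) {τ : ℝ} (hτ : 1 ≤ τ) :
    |argGammaVert σ τ - (τ * Real.log τ - τ) - stirlingArgConst σ + (σ ^ 2 / 2 - σ / 2 + 1 / 12) / τ| ≤
      (σ ^ 4 / 2 + σ ^ 3 / 2 + (3 * σ ^ 2 + σ ^ 4) / 12 + 1 / 120 + 5 / (4 * π ^ 3 * σ)) / (3 * τ ^ 3) := by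
  set E : ℝ → ℝ := fun τ ↦ argGammaVert σ τ - (τ * Real.log τ - τ) with hE
  set E' : ℝ → ℝ := fun u ↦ (digamma (σ + u * I)).re - Real.log u with hE'
  set a : ℝ := σ ^ 2 / 2 - σ / 2 + 1 / 12 with ha
  set K : ℝ := σ ^ 4 / 2 + σ ^ 3 / 2 + (3 * σ ^ 2 + σ ^ 4) / 12 + 1 / 120 + 5 / (4 * π ^ 3 * σ) with hK
  have hτ0 : 0 < τ := by linarith
  have hK0 : 0 ≤ K := by positivity
  -- FTC on `[1, τ]`
  have hFTC : ∫ u in (1 : ℝ)..τ, E' u = E τ - E 1 := by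
    refine intervalIntegral.integral_eq_sub_of_hasDerivAt (fun u hu ↦ ?_) ?_
    · rw [uIcc_of_le hτ] at hu
      exact hasDerivAt_argGammaVert_sub hσ (by linarith [hu.1])
    · refine ContinuousOn.intervalIntegrable ?_
      rw [uIcc_of_le hτ]
      exact (continuousOn_re_digamma_vertical_sub_log hσ).mono fun u hu ↦ by
        simp only [mem_Ioi]; linarith [hu.1]
  -- splitting the improper integral at `τ`
  have hI1 := integrableOn_re_digamma_vertical_sub_log (σ := σ) (a := 1) hσ le_rfl
  have hIτ := integrableOn_re_digamma_vertical_sub_log hσ hτ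
  have hsplit : ∫ u in Ioi (1 : ℝ), E' u = (∫ u in (1 : ℝ)..τ, E' u) + ∫ u in Ioi τ, E' u := by
    rw [intervalIntegral.integral_of_le hτ, ← setIntegral_union (Ioc_disjoint_Ioi le_rfl)
      measurableSet_Ioi (hI1.mono_set Ioc_subset_Ioi_self) hIτ, Ioc_union_Ioi_eq_Ioi hτ]
  have hE1 : E 1 = argGammaVert σ 1 + 1 := by simp [hE]
  have hc : stirlingArgConst σ = E 1 + ∫ u in Ioi (1 : ℝ), E' u := by
    rw [stirlingArgConst, hE1]
  have hmain : E τ - stirlingArgConst σ = -∫ u in Ioi τ, E' u := by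
    rw [hc, hsplit, hFTC]; ring
  -- the `a/u²` part and the remainder
  have hIa : IntegrableOn (fun u : ℝ ↦ a * u ^ (-2 : ℝ)) (Ioi τ) :=
    (integrableOn_Ioi_rpow_of_lt (by norm_num) hτ0).const_mul _
  have hIa_val : ∫ u in Ioi τ, a * u ^ (-2 : ℝ) = a / τ := by
    rw [MeasureTheory.integral_const_mul, integral_Ioi_rpow_of_lt (by norm_num) hτ0]
    rw [show (-2 : ℝ) + 1 = -1 by norm_num, Real.rpow_neg_one]
    field_simp
  have hIr : IntegrableOn (fun u : ℝ ↦ E' u - a * u ^ (-2 : ℝ)) (Ioi τ) := hIτ.sub hIa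
  have hsplit2 : ∫ u in Ioi τ, E' u = a / τ + ∫ u in Ioi τ, (E' u - a * u ^ (-2 : ℝ)) := by
    rw [integral_sub hIτ hIa, hIa_val]; ring
  -- tail bound for the remainder
  have htail : |∫ u in Ioi τ, (E' u - a * u ^ (-2 : ℝ))| ≤ K / (3 * τ ^ 3) := by
    have hg : IntegrableOn (fun u : ℝ ↦ K * u ^ (-4 : ℝ)) (Ioi τ) :=
      (integrableOn_Ioi_rpow_of_lt (by norm_num) hτ0).const_mul _
    have hle := MeasureTheory.norm_integral_le_of_norm_le (μ := volume.restrict (Ioi τ))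
      (f := fun u : ℝ ↦ E' u - a * u ^ (-2 : ℝ)) hg
      ((ae_restrict_iff' measurableSet_Ioi).2 (Eventually.of_forall fun u hu ↦ by
        have hu1 : 1 ≤ u := hτ.trans (le_of_lt hu)
        have hu0 : 0 < u := by linarith
        have := abs_re_digamma_vertical_sub_log_sub_le hσ hu1
        change ‖E' u - a * u ^ (-2 : ℝ)‖ ≤ K * u ^ (-4 : ℝ)
        rw [Real.norm_eq_abs]
        have e1 : E' u - a * u ^ (-2 : ℝ) =
            (digamma (σ + u * I)).re - Real.log u - (σ ^ 2 / 2 - σ / 2 + 1 / 12) / u ^ 2 := by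
          simp only [hE', ha]
          rw [Real.rpow_neg hu0.le, show (2 : ℝ) = ((2 : ℕ) : ℝ) by norm_num, Real.rpow_natCast]
          ring
        rw [e1]
        refine this.trans (le_of_eq ?_)
        rw [hK, Real.rpow_neg hu0.le, show (4 : ℝ) = ((4 : ℕ) : ℝ) by norm_num, Real.rpow_natCast,
          div_eq_mul_inv]))
    rw [Real.norm_eq_abs] at hle
    refine hle.trans (le_of_eq ?_)
    rw [MeasureTheory.integral_const_mul, integral_Ioi_rpow_of_lt (by norm_num) hτ0]
    rw [show (-4 : ℝ) + 1 = -3 by norm_num, Real.rpow_neg hτ0.le,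
      show (3 : ℝ) = ((3 : ℕ) : ℝ) by norm_num, Real.rpow_natCast]
    field_simp
  have hgoal : E τ - stirlingArgConst σ + a / τ = -∫ u in Ioi τ, (E' u - a * u ^ (-2 : ℝ)) := by
    rw [hmain, hsplit2]; ring
  show |E τ - stirlingArgConst σ + a / τ| ≤ K / (3 * τ ^ 3)
  rw [hgoal, abs_neg]
  exact htail

/-! ### `θ` to second order -/

/-- `8K₂(¼)/3 ≤ 0.53`. [folklore] -/
private lemma K_quarter_le :
    ((1 / 4 : ℝ) ^ 4 / 2 + (1 / 4 : ℝ) ^ 3 / 2 + (3 * (1 / 4 : ℝ) ^ 2 + (1 / 4 : ℝ) ^ 4) / 12 + 1 / 120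
      + 5 / (4 * π ^ 3 * (1 / 4))) / (3 * (1 / 2) ^ 3) ≤ 0.53 := by
  have hπ : 3.14159 < π := by linarith [Real.pi_gt_d6]
  have hπ3 : 31 < π ^ 3 := by
    have := pow_lt_pow_left₀ hπ (by norm_num : (0 : ℝ) ≤ 3.14159) three_ne_zero
    norm_num at this
    linarith
  have h5 : 5 / (4 * π ^ 3 * (1 / 4)) ≤ 5 / 31 := by
    rw [show 4 * π ^ 3 * (1 / 4 : ℝ) = π ^ 3 by ring]
    exact div_le_div_of_nonneg_left (by norm_num) (by norm_num) hπ3.le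
  have : ((1 / 4 : ℝ) ^ 4 / 2 + (1 / 4 : ℝ) ^ 3 / 2 + (3 * (1 / 4 : ℝ) ^ 2 + (1 / 4 : ℝ) ^ 4) / 12 + 1 / 120
      + 5 / (4 * π ^ 3 * (1 / 4))) ≤ 0.19875 := by
    norm_num at h5 ⊢
    linarith
  rw [div_le_iff₀ (by norm_num)]
  norm_num at this ⊢
  linarith

/-- **Second-order Stirling for `θ`**: for `t ≥ 2`,
`|θ(t) − ((t/2) log(t/2π) − t/2 − π/8 + 1/(48t))| ≤ 0.53/t³` (the true next term is `7/(5760t³)`;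
Brent–Platt–Trudgian's Lemma 2 rests on Brent's sharp three-term remainder). From
`abs_argGammaVert_sub_stirling_two_le` at `σ = ¼`, `τ = t/2` (`a(¼) = −1/96`, `c(¼) = −π/8`).
[cite: BrentPlattTrudgian2021, Lemma 2 (proof)] -/
theorem abs_riemannSiegelTheta_sub_stirling_two_le {t : ℝ} (ht : 2 ≤ t) :
    |riemannSiegelTheta t - (t / 2 * Real.log (t / (2 * π)) - t / 2 - π / 8 + 1 / (48 * t))| ≤
      0.53 / t ^ 3 := by
  have hτ : 1 ≤ t / 2 := by linarith
  have ht0 : 0 < t := by linarith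
  have h := abs_argGammaVert_sub_stirling_two_le (σ := 1 / 4) (by norm_num) hτ
  rw [stirlingArgConst_one_quarter] at h
  have hlog : Real.log (t / 2) - Real.log π = Real.log (t / (2 * π)) := by
    rw [← Real.log_div (by positivity) Real.pi_ne_zero, div_div]
  have e : riemannSiegelTheta t - (t / 2 * Real.log (t / (2 * π)) - t / 2 - π / 8 + 1 / (48 * t)) =
      argGammaVert (1 / 4) (t / 2) - (t / 2 * Real.log (t / 2) - t / 2) - -(π / 8)
        + ((1 / 4 : ℝ) ^ 2 / 2 - 1 / 4 / 2 + 1 / 12) / (t / 2) := by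
    rw [riemannSiegelTheta_eq_argGammaVert, ← hlog]
    field_simp
    ring
  rw [e]
  refine h.trans ?_
  have hK := K_quarter_le
  have ht3 : 0 < t ^ 3 := by positivity
  calc ((1 / 4 : ℝ) ^ 4 / 2 + (1 / 4 : ℝ) ^ 3 / 2 + (3 * (1 / 4 : ℝ) ^ 2 + (1 / 4 : ℝ) ^ 4) / 12 + 1 / 120
        + 5 / (4 * π ^ 3 * (1 / 4))) / (3 * (t / 2) ^ 3)
      = ((1 / 4 : ℝ) ^ 4 / 2 + (1 / 4 : ℝ) ^ 3 / 2 + (3 * (1 / 4 : ℝ) ^ 2 + (1 / 4 : ℝ) ^ 4) / 12 + 1 / 120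
        + 5 / (4 * π ^ 3 * (1 / 4))) / (3 * (1 / 2) ^ 3) / t ^ 3 := by
        field_simp
    _ ≤ 0.53 / t ^ 3 := div_le_div_of_nonneg_right hK ht3.le

/-! ### `Q(t) − S(t)` to second order, and Brent–Platt–Trudgian's Lemma 2 from `t = 70` on -/

/-- `Q(t) − S(t) = (θ(t) − ((t/2) log(t/2π) − t/2 − π/8))/π` for every `t`: `N = θ/π + 1 + S`
(definition of `zetaArgS`) and `L(t) = countMain t = (t/2π) log(t/2π) − t/2π + 7/8`.
[cite: Titchmarsh1986, Thm. 9.3] -/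
theorem count_sub_countMain_sub_zetaArgS_eq (t : ℝ) :
    ((zetaZeroCount t : ℝ) - countMain t) - zetaArgS t =
      (riemannSiegelTheta t - (t / 2 * Real.log (t / (2 * π)) - t / 2 - π / 8)) / π := by
  rw [zetaZeroCount_eq_theta_add_zetaArgS, countMain]
  field_simp
  ring

/-- **`|Q(t) − S(t) − 1/(48πt)| ≤ 0.53/(πt³)`** for `t ≥ 2` (second-order form of the tree's
`|Q − S| ≤ 1.2/(πt)`, `abs_zetaZeroCount_sub_main_sub_zetaArgS_le`).
[cite: BrentPlattTrudgian2021, Lemma 2 (proof)] -/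
theorem abs_count_sub_countMain_sub_zetaArgS_sub_le {t : ℝ} (ht : 2 ≤ t) :
    |((zetaZeroCount t : ℝ) - countMain t) - zetaArgS t - 1 / (48 * π * t)| ≤ 0.53 / (π * t ^ 3) := by
  have hπ := Real.pi_pos
  have ht0 : 0 < t := by linarith
  have h := abs_riemannSiegelTheta_sub_stirling_two_le ht
  rw [count_sub_countMain_sub_zetaArgS_eq]
  have e : (riemannSiegelTheta t - (t / 2 * Real.log (t / (2 * π)) - t / 2 - π / 8)) / π - 1 / (48 * π * t)
      = (riemannSiegelTheta t - (t / 2 * Real.log (t / (2 * π)) - t / 2 - π / 8 + 1 / (48 * t))) / π := by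
    field_simp
    ring
  rw [e, abs_div, abs_of_pos hπ, div_le_iff₀ hπ]
  refine h.trans (le_of_eq ?_)
  field_simp

/-- **Brent–Platt–Trudgian 2021, Lemma 2, for `t ≥ 70`** — the inequality of the named fact
`BrentPlattTrudgian2021_lemma2` (`|Q(t) − S(t)| ≤ 1/(150t)`, printed for `t ≥ 2π`) PROVED on
`[70, ∞)`: `1/(48π) + 0.53/(π·70²) < 1/150`. (On `[2π, 70)` the printed constant needs Brent's
three-term remainder `7/(5760t³) + …` in place of `0.53/t³`.) [cite: BrentPlattTrudgian2021, Lemma 2] -/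
theorem BrentPlattTrudgian2021_lemma2.of_seventy_le {t : ℝ} (ht : 70 ≤ t) :
    |((zetaZeroCount t : ℝ) - countMain t) - zetaArgS t| ≤ 1 / (150 * t) := by
  have hπ : 3.14159 < π := by linarith [Real.pi_gt_d6]
  have hπ0 := Real.pi_pos
  have ht0 : 0 < t := by linarith
  have h := abs_count_sub_countMain_sub_zetaArgS_sub_le (by linarith : (2 : ℝ) ≤ t)
  have h1 : |((zetaZeroCount t : ℝ) - countMain t) - zetaArgS t| ≤
      1 / (48 * π * t) + 0.53 / (π * t ^ 3) := by
    have := abs_add_le (((zetaZeroCount t : ℝ) - countMain t) - zetaArgS t - 1 / (48 * π * t))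
      (1 / (48 * π * t))
    rw [sub_add_cancel, abs_of_pos (by positivity : (0 : ℝ) < 1 / (48 * π * t))] at this
    linarith
  refine h1.trans ?_
  -- `0.53/(π t³) ≤ (0.53/4900)/(π t)` and `(1/48 + 0.53/4900)·150 ≤ π`
  have ht2 : 4900 ≤ t ^ 2 := by nlinarith
  have h2 : 0.53 / (π * t ^ 3) ≤ 0.53 / 4900 / (π * t) := by
    rw [div_div, div_le_div_iff_of_pos_left (by norm_num) (by positivity) (by positivity)]
    calc 4900 * (π * t) = π * t * 4900 := by ring
      _ ≤ π * t * t ^ 2 := by gcongr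
      _ = π * t ^ 3 := by ring
  have h3 : 1 / (48 * π * t) + 0.53 / 4900 / (π * t) = (1 / 48 + 0.53 / 4900) / (π * t) := by
    field_simp
  have h4 : (1 / 48 + 0.53 / 4900) / (π * t) ≤ 1 / (150 * t) := by
    rw [div_le_div_iff₀ (by positivity) (by positivity)]
    have hc : (1 / 48 + 0.53 / 4900 : ℝ) * 150 ≤ 3.14159 := by norm_num
    nlinarith
  linarith

end Literature.NumberTheory.LFunctions
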